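import Mathlib
import Summits.CriticalPhenomena.PercolationContinuityZ3.Theorems.PercNearOneGluingNearOneGluingExclusivity
import Summits.CriticalPhenomena.PercolationContinuityZ3.Theorems.PercNearOneGluingNearOneGluingLaminar
import HarnessLib

/-!
# Crux `PercNearOneGluing.NearOneGluing` (stmt-CriticalPhenomena-4574), line `SketchR2I5` — LAMINAR FOOTPRINTS (percolation form)

Lead prover-line-stmt-CriticalPhenomena-4574-c2-0, 2026-08-16.  Lands with `--supports stmt-CriticalPhenomena-4574`.

Instantiates the abstract laminar theorem (`laminar_mass_le`, file …Laminar.lean) with the footprint of the bad event of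
Kozma–Nitzan's Conjecture 3: `μ = prodBernoulli w` on bond configurations of `Fin n`, relays `A ∌ o, b`, footprint
`R(ω) = {a ∈ A : o ↔ a}`, mass `m S = μ(o ↮ b, R = S)`.
* (T1) `Σ_{S ∋ a} m S = μ(o ↮ b, a ∈ R) ≤ μ(a ↮ b) ≤ δ` (transitivity of `↔`);
* (T2) for pairwise disjoint nonempty blocks `B_i ⊆ A` with block masses `≤ η`:
  `Σ_i μ(o ↮ b, ∅ ≠ R ⊆ B_i) ≤ 2 log(1/p₀) · (3δ + η)`, from the landed EXCLUSIVITY LEMMA (`exclusivity_family`, p112977) applied to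
  the targets `{b}`, the blocks, and the singletons of the uncovered relays (`p₀ = μ(o ↮ A ∪ {b}) ≤ δ`, assumed `> 0`);
* hence (`laminarFootprints`) for every LAMINAR family `𝓛` of nonempty relay sets:
  `Σ_{S ∈ 𝓛} μ(o ↮ b, R = S) ≤ 2 √(δ · bad · Λ) + 3 δ Λ`, `Λ = 2 log(1/p₀)`, `bad = μ(o ↮ b, o ↔ A)`.
So a would-be counterexample at `(ε, δ)` (bad `≥ ε`, `p₀ ≍ δ`) can put only `O(√(ε δ log(1/δ)))` of its bad mass on any laminar
family of footprints: the footprints must cross essentially (Cruxes/NearOneGluing/NOTES.md §C.5); every "tree of pockets" family is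
`O(δ log(1/δ))`.
-/

namespace Summit.CriticalPhenomena.PercolationContinuityZ3.Theorems

open scoped BigOperators Classical
open MeasureTheory Set Finset
open Literature.Probability.LatticeModels (prodBernoulli)
open Literature.Probability.Percolation

section LaminarFootprints

variable {n : ℕ}

/-- Masses of the exact-footprint events sum to the measure of the union: for a family `F` of relay sets,
`Σ_{S∈F} μ(o ↮ b, R = S) = μ(o ↮ b, R ∈ F)` with `R(ω) = {a ∈ A : o ↔ a}`. [folklore] -/
theorem sum_footprintMass_eq (w : Sym2 (Fin n) → unitInterval) (A : Finset (Fin n)) (o b : Fin n)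
    (F : Finset (Finset (Fin n))) :
    ∑ S ∈ F, (prodBernoulli w).real
        {ω | ω ∉ openConn o b ∧ A.filter (fun a => ω ∈ openConn o a) = S} =
      (prodBernoulli w).real
        {ω | ω ∉ openConn o b ∧ A.filter (fun a => ω ∈ openConn o a) ∈ F} := by
  classical
  have hdisj : PairwiseDisjoint (↑F : Set (Finset (Fin n)))
      (fun S => {ω : Set (Sym2 (Fin n)) | ω ∉ openConn o b ∧ A.filter (fun a => ω ∈ openConn o a) = S}) := by
    intro S _ T _ hST
    rw [Function.onFun, Set.disjoint_left]
    rintro ω ⟨_, hS⟩ ⟨_, hT⟩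
    exact hST (hS.symm.trans hT)
  rw [← measureReal_biUnion_finset hdisj (fun _ _ => MeasurableSet.of_discrete)]
  congr 1
  ext ω
  simp only [Set.mem_iUnion, Set.mem_setOf_eq, exists_prop]
  constructor
  · rintro ⟨S, hS, hob, hRS⟩
    exact ⟨hob, hRS ▸ hS⟩
  · rintro ⟨hob, hR⟩
    exact ⟨_, hR, hob, rfl⟩

/-- **(T1) accumulation.** `Σ_{S ∋ a} μ(o ↮ b, R = S) ≤ μ(a ↮ b)`: on each such event `o ↔ a` and `o ↮ b`, so `a ↮ b`.
[cite: KozmaNitzan2024, Conj. 3 p.15 (context)] -/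
theorem footprint_accumulation (w : Sym2 (Fin n) → unitInterval) (A : Finset (Fin n)) (o b a : Fin n) :
    ∑ S ∈ A.powerset.filter (fun S => a ∈ S), (prodBernoulli w).real
        {ω | ω ∉ openConn o b ∧ A.filter (fun a => ω ∈ openConn o a) = S} ≤
      (prodBernoulli w).real (openConn a b)ᶜ := by
  classical
  rw [sum_footprintMass_eq]
  refine measureReal_mono ?_ (measure_ne_top _ _)
  rintro ω ⟨hob, hR⟩ hab
  have haR : a ∈ A.filter (fun a => ω ∈ openConn o a) := (Finset.mem_filter.1 hR).2
  have hoa : ω ∈ openConn o a := (Finset.mem_filter.1 haR).2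
  exact hob (SimpleGraph.Reachable.trans hoa hab)

/-- **(T2) exclusivity for blocks of relays**, from the landed EXCLUSIVITY LEMMA.  For pairwise disjoint nonempty blocks
`B_i ⊆ A` whose block masses `μ(o ↮ b, ∅ ≠ R ⊆ B_i)` are `≤ η` (`η ≥ 0`), with `p₀ = μ(o ↮ b, o ↮ A) ∈ (0, δ]`, `δ < 1`,
`μ(o ↮ A) ≤ δ`, `μ(a ↮ b) ≤ δ`:   `Σ_i μ(o ↮ b, ∅ ≠ R ⊆ B_i) ≤ 2 log(1/p₀) · (3δ + η)`.
[cite: VandenbergHaggstromKahn2005, Thm 1.1; KozmaNitzan2024, Conj. 3 p.15 (context)] -/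
theorem footprint_block_exclusivity (w : Sym2 (Fin n) → unitInterval) (A : Finset (Fin n)) (o b : Fin n)
    (ho : o ∉ A) (hb : b ∉ A) (hob : o ≠ b) (δ : ℝ) (hδ1 : δ < 1)
    (hA : (prodBernoulli w).real (⋃ a ∈ A, openConn o a)ᶜ ≤ δ)
    (hrel : ∀ a ∈ A, (prodBernoulli w).real (openConn a b)ᶜ ≤ δ)
    (hp0 : 0 < (prodBernoulli w).real {ω | ω ∉ openConn o b ∧ ∀ a ∈ A, ω ∉ openConn o a})
    (ℬ : Finset (Finset (Fin n))) (η : ℝ) (hη : 0 ≤ η) (hℬA : ∀ B ∈ ℬ, B ⊆ A ∧ B.Nonempty)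
    (hℬdisj : ∀ B ∈ ℬ, ∀ B' ∈ ℬ, B ≠ B' → Disjoint B B')
    (hℬη : ∀ B ∈ ℬ, ∑ S ∈ A.powerset.filter (fun S => S.Nonempty ∧ S ⊆ B), (prodBernoulli w).real
        {ω | ω ∉ openConn o b ∧ A.filter (fun a => ω ∈ openConn o a) = S} ≤ η) :
    ∑ B ∈ ℬ, ∑ S ∈ A.powerset.filter (fun S => S.Nonempty ∧ S ⊆ B), (prodBernoulli w).real
        {ω | ω ∉ openConn o b ∧ A.filter (fun a => ω ∈ openConn o a) = S} ≤
      (2 * Real.log (1 / (prodBernoulli w).real {ω | ω ∉ openConn o b ∧ ∀ a ∈ A, ω ∉ openConn o a})) *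
        (3 * δ + η) := by
  classical
  set p₀ := (prodBernoulli w).real {ω | ω ∉ openConn o b ∧ ∀ a ∈ A, ω ∉ openConn o a} with hp₀def
  -- the family of targets, indexed by their vertex sets
  let cov : Finset (Fin n) := ℬ.biUnion id
  let sing : Finset (Finset (Fin n)) := (A \ cov).image fun a => ({a} : Finset (Fin n))
  let J : Finset (Finset (Fin n)) := insert {b} (ℬ ∪ sing)
  let Q : Finset (Fin n) → Set (Fin n) := fun T => (↑T : Set (Fin n))
  -- basic facts about J
  have hℬJ : ℬ ⊆ J := fun B hB => Finset.mem_insert_of_mem (Finset.mem_union_left _ hB)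
  have hJ : J.Nonempty := ⟨{b}, Finset.mem_insert_self _ _⟩
  have hmemJ : ∀ T ∈ J, T = {b} ∨ T ∈ ℬ ∨ ∃ a ∈ A \ cov, T = {a} := by
    intro T hT
    rcases Finset.mem_insert.1 hT with h | h
    · exact Or.inl h
    · rcases Finset.mem_union.1 h with h | h
      · exact Or.inr (Or.inl h)
      · right; right
        obtain ⟨a, ha, rfl⟩ := Finset.mem_image.1 h
        exact ⟨a, ha, rfl⟩
  have hs : ∀ T ∈ J, o ∉ Q T := by
    intro T hT hoT
    rcases hmemJ T hT with rfl | h | ⟨a, ha, rfl⟩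
    · exact hob (by simpa [Q] using hoT)
    · exact ho ((hℬA T h).1 (by simpa [Q] using hoT))
    · have : o = a := by simpa [Q] using hoT
      exact ho (this ▸ (Finset.mem_sdiff.1 ha).1)
  -- every relay lies in a target other than `{b}`; the union of all targets is `A ∪ {b}`
  have hcoverA : ∀ a ∈ A, ∃ T ∈ J, T ≠ {b} ∧ a ∈ T := by
    intro a ha
    by_cases hac : a ∈ cov
    · obtain ⟨B, hB, haB⟩ := Finset.mem_biUnion.1 hac
      refine ⟨B, hℬJ hB, ?_, by simpa using haB⟩
      rintro rfl
      exact hb ((hℬA _ hB).1 (Finset.mem_singleton_self b))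
    · refine ⟨{a}, Finset.mem_insert_of_mem (Finset.mem_union_right _
        (Finset.mem_image.2 ⟨a, Finset.mem_sdiff.2 ⟨ha, hac⟩, rfl⟩)), ?_, Finset.mem_singleton_self a⟩
      intro h
      have : a = b := Finset.singleton_injective h
      exact hb (this ▸ ha)
  have hTsub : ∀ T ∈ J, T ≠ {b} → T ⊆ A := by
    intro T hT hTb
    rcases hmemJ T hT with rfl | h | ⟨a, ha, rfl⟩
    · exact absurd rfl hTb
    · exact (hℬA T h).1
    · exact Finset.singleton_subset_iff.2 (Finset.mem_sdiff.1 ha).1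
  -- p₀ as an avoidance probability of the whole target union
  have hp₀eq : (prodBernoulli w).real {ω | ∀ z ∈ ⋃ k ∈ J, Q k, ¬ (openGraph ω).Reachable o z} = p₀ := by
    rw [hp₀def]
    congr 1
    ext ω
    simp only [Set.mem_iUnion, exists_prop, Set.mem_setOf_eq, forall_exists_index, and_imp]
    constructor
    · intro h
      refine ⟨fun hob' => h b {b} (Finset.mem_insert_self _ _) (by simp [Q]) hob', fun a ha hoa => ?_⟩
      obtain ⟨T, hT, _, haT⟩ := hcoverA a ha
      exact h a T hT (by simpa [Q] using haT) hoa
    · rintro ⟨hob', hA'⟩ z T hT hzT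
      rcases hmemJ T hT with rfl | h | ⟨a, ha, rfl⟩
      · have : z = b := by simpa [Q] using hzT
        subst this; exact hob'
      · exact hA' z ((hℬA T h).1 (by simpa [Q] using hzT))
      · have : z = a := by simpa [Q] using hzT
        subst this; exact hA' z (Finset.mem_sdiff.1 ha).1
  have hp0' : 0 < (prodBernoulli w).real {ω | ∀ z ∈ ⋃ k ∈ J, Q k, ¬ (openGraph ω).Reachable o z} := by rw [hp₀eq]; exact hp0
  have hp₀δ : p₀ ≤ δ := by
    refine le_trans (measureReal_mono ?_ (measure_ne_top _ _)) hA
    rintro ω ⟨_, hA'⟩ hω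
    simp only [Set.mem_iUnion, exists_prop] at hω
    obtain ⟨a, ha, hoa⟩ := hω
    exact hA' a ha hoa
  have hp1' : (prodBernoulli w).real {ω | ∀ z ∈ ⋃ k ∈ J, Q k, ¬ (openGraph ω).Reachable o z} < 1 := by
    rw [hp₀eq]; exact lt_of_le_of_lt hp₀δ hδ1
  -- the "exactly T" events
  let X : Finset (Fin n) → Set (Set (Sym2 (Fin n))) := fun T =>
    {ω | ∃ z ∈ Q T, (openGraph ω).Reachable o z} ∩
      {ω | ∀ z ∈ ⋃ k ∈ J.erase T, Q k, ¬ (openGraph ω).Reachable o z}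
  -- for a block: X B is the event {o ↮ b, ∅ ≠ R ⊆ B}
  have hXB : ∀ B ∈ ℬ, (prodBernoulli w).real (X B) = ∑ S ∈ A.powerset.filter (fun S => S.Nonempty ∧ S ⊆ B), (prodBernoulli w).real
      {ω | ω ∉ openConn o b ∧ A.filter (fun a => ω ∈ openConn o a) = S} := by
    intro B hB
    rw [sum_footprintMass_eq]
    congr 1
    ext ω
    simp only [X, Q, Set.mem_inter_iff, Set.mem_setOf_eq, Finset.mem_coe, Set.mem_iUnion, exists_prop,
      Finset.mem_filter, Finset.mem_powerset]
    constructor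
    · rintro ⟨⟨z, hzB, hoz⟩, havoid⟩
      have hBb : B ≠ {b} := by
        rintro rfl
        exact hb ((hℬA _ hB).1 (Finset.mem_singleton_self b))
      refine ⟨fun hob' => havoid b ⟨{b}, Finset.mem_erase.2 ⟨Ne.symm hBb, Finset.mem_insert_self _ _⟩,
        Finset.mem_singleton_self b⟩ hob', Finset.filter_subset _ _, ?_, ?_⟩
      · exact ⟨z, Finset.mem_filter.2 ⟨(hℬA B hB).1 hzB, hoz⟩⟩
      · intro a ha
        have ha' := Finset.mem_filter.1 ha
        by_contra haB
        -- a lies in some other target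
        obtain ⟨T, hT, hTb, haT⟩ := hcoverA a ha'.1
        have hTB : T ≠ B := by rintro rfl; exact haB haT
        exact havoid a ⟨T, Finset.mem_erase.2 ⟨hTB, hT⟩, haT⟩ ha'.2
    · rintro ⟨hob', _, ⟨z, hz⟩, hRB⟩
      have hz' := Finset.mem_filter.1 hz
      refine ⟨⟨z, hRB hz, hz'.2⟩, ?_⟩
      rintro y ⟨T, hT, hyT⟩ hoy
      have hT' := Finset.mem_erase.1 hT
      rcases hmemJ T hT'.2 with rfl | h | ⟨a, ha, rfl⟩
      · have : y = b := Finset.mem_singleton.1 hyT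
        subst this; exact hob' hoy
      · -- another block: disjoint from B, but y ∈ R ⊆ B
        have hyA : y ∈ A := (hℬA T h).1 hyT
        have hyB : y ∈ B := hRB (Finset.mem_filter.2 ⟨hyA, hoy⟩)
        exact Finset.disjoint_left.1 (hℬdisj T h B hB hT'.1) hyT hyB
      · have hya : y = a := Finset.mem_singleton.1 hyT
        subst hya
        have hyA : y ∈ A := (Finset.mem_sdiff.1 ha).1
        have hyB : y ∈ B := hRB (Finset.mem_filter.2 ⟨hyA, hoy⟩)
        exact (Finset.mem_sdiff.1 ha).2 (Finset.mem_biUnion.2 ⟨B, hB, hyB⟩)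
  -- bounds for the other targets
  have hXsingle : ∀ a ∈ A \ cov, (prodBernoulli w).real (X {a}) ≤ δ := by
    intro a ha
    have haA : a ∈ A := (Finset.mem_sdiff.1 ha).1
    refine le_trans (measureReal_mono ?_ (measure_ne_top _ _)) (hrel a haA)
    rintro ω ⟨⟨z, hz, hoz⟩, havoid⟩ hab
    have hza : z = a := by simpa [Q] using hz
    subst hza
    have hne : ({b} : Finset (Fin n)) ≠ {z} := by
      intro h
      have : b = z := Finset.singleton_injective h
      exact hb (this ▸ haA)
    exact havoid b (Set.mem_iUnion₂.2 ⟨{b}, Finset.mem_erase.2 ⟨hne, Finset.mem_insert_self _ _⟩,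
      by simp [Q]⟩) (hoz.trans hab)
  have hXb : (prodBernoulli w).real (X {b}) ≤ δ := by
    refine le_trans (measureReal_mono ?_ (measure_ne_top _ _)) hA
    rintro ω ⟨_, havoid⟩ hω
    simp only [Set.mem_iUnion, exists_prop] at hω
    obtain ⟨a, ha, hoa⟩ := hω
    obtain ⟨T, hT, hTb, haT⟩ := hcoverA a ha
    exact havoid a (Set.mem_iUnion₂.2 ⟨T, Finset.mem_erase.2 ⟨hTb, hT⟩, by simpa [Q] using haT⟩) hoa
  -- apply the exclusivity lemma with η' = max η δ
  have hδ0 : 0 ≤ δ := le_of_lt (lt_of_lt_of_le hp0 hp₀δ)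
  have hη' : ∀ T ∈ J, (prodBernoulli w).real (X T) ≤ max η δ := by
    intro T hT
    rcases hmemJ T hT with rfl | h | ⟨a, ha, rfl⟩
    · exact hXb.trans (le_max_right _ _)
    · rw [hXB T h]; exact (hℬη T h).trans (le_max_left _ _)
    · exact (hXsingle a ha).trans (le_max_right _ _)
  have hexcl := exclusivity_family w o Q J hs hJ (max η δ) hp0' hp1' hη'
  rw [hp₀eq] at hexcl
  have hsub : ∑ B ∈ ℬ, (prodBernoulli w).real (X B) ≤ ∑ T ∈ J, (prodBernoulli w).real (X T) :=
    Finset.sum_le_sum_of_subset_of_nonneg hℬJ fun _ _ _ => measureReal_nonneg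
  have hL : ∑ B ∈ ℬ, ∑ S ∈ A.powerset.filter (fun S => S.Nonempty ∧ S ⊆ B), (prodBernoulli w).real
      {ω | ω ∉ openConn o b ∧ A.filter (fun a => ω ∈ openConn o a) = S} =
      ∑ B ∈ ℬ, (prodBernoulli w).real (X B) := Finset.sum_congr rfl fun B hB => (hXB B hB).symm
  rw [hL]
  have hlog : 0 ≤ Real.log (1 / p₀) := by
    refine Real.log_nonneg ?_
    rw [le_div_iff₀ hp0]
    linarith
  have hmax : max η δ ≤ η + δ := max_le (by linarith) (by linarith)
  have h1 : p₀ + max η δ ≤ 3 * δ + η := by linarith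
  calc ∑ B ∈ ℬ, (prodBernoulli w).real (X B) ≤ ∑ T ∈ J, (prodBernoulli w).real (X T) := hsub
    _ ≤ 2 * (p₀ + max η δ) * Real.log (1 / p₀) := hexcl
    _ = 2 * Real.log (1 / p₀) * (p₀ + max η δ) := by ring
    _ ≤ 2 * Real.log (1 / p₀) * (3 * δ + η) := mul_le_mul_of_nonneg_left h1 (by positivity)

/-- The bad mass as a sum of exact-footprint masses: `Σ_{∅≠S⊆A} μ(o ↮ b, R = S) = μ(o ↮ b, o ↔ A)`. [folklore] -/
theorem sum_footprintMass_nonempty_eq (w : Sym2 (Fin n) → unitInterval) (A : Finset (Fin n)) (o b : Fin n) :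
    ∑ S ∈ A.powerset.filter (fun S => S.Nonempty), (prodBernoulli w).real
        {ω | ω ∉ openConn o b ∧ A.filter (fun a => ω ∈ openConn o a) = S} =
      (prodBernoulli w).real {ω | ω ∉ openConn o b ∧ ∃ a ∈ A, ω ∈ openConn o a} := by
  rw [sum_footprintMass_eq]
  congr 1
  ext ω
  simp only [Set.mem_setOf_eq, Finset.mem_filter, Finset.mem_powerset]
  constructor
  · rintro ⟨hob, _, ⟨a, ha⟩⟩
    exact ⟨hob, a, (Finset.mem_filter.1 ha).1, (Finset.mem_filter.1 ha).2⟩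
  · rintro ⟨hob, a, haA, hoa⟩
    exact ⟨hob, Finset.filter_subset _ _, ⟨a, Finset.mem_filter.2 ⟨haA, hoa⟩⟩⟩

/-- **Laminar footprints theorem** (crux anatomy, `|A|`-free).  Hypotheses of Kozma–Nitzan's Conjecture 3 at level `δ < 1`
(`μ(o ↮ A) ≤ δ`, `μ(a ↮ b) ≤ δ` for `a ∈ A`, `o, b ∉ A`, `o ≠ b`) and `p₀ := μ(o ↮ b, o ↮ A) > 0`.  Then for every LAMINAR
family `𝓛` of nonempty relay sets (any two members disjoint or nested), the bad mass whose footprint `R = {a ∈ A : o ↔ a}` lies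
in `𝓛` obeys  `Σ_{S∈𝓛} μ(o ↮ b, R = S) ≤ 2 √(δ · μ(o ↮ b, o ↔ A) · Λ) + 3 δ Λ`,  `Λ = 2 log(1/p₀)`.
With `p₀ ≍ δ` (attach `o` through a `(1-δ)`-edge) `Λ ≍ log(1/δ)`: a counterexample family (bad `≥ ε`, `δ → 0`) keeps only a
vanishing fraction `O(√(δ log(1/δ)/ε))` of its bad mass on any laminar family — its footprints must cross; every laminar
("tree of pockets", nested rooms, petals of petals) enemy is `O(δ log(1/δ))`.
[cite: VandenbergHaggstromKahn2005, Thm 1.1; KozmaNitzan2024, Conj. 3 p.15 (context)] -/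
theorem laminarFootprints (w : Sym2 (Fin n) → unitInterval) (A : Finset (Fin n)) (o b : Fin n)
    (ho : o ∉ A) (hb : b ∉ A) (hob : o ≠ b) (δ : ℝ) (hδ1 : δ < 1)
    (hA : (prodBernoulli w).real (⋃ a ∈ A, openConn o a)ᶜ ≤ δ)
    (hrel : ∀ a ∈ A, (prodBernoulli w).real (openConn a b)ᶜ ≤ δ)
    (hp0 : 0 < (prodBernoulli w).real {ω | ω ∉ openConn o b ∧ ∀ a ∈ A, ω ∉ openConn o a})
    (𝓛 : Finset (Finset (Fin n))) (h𝓛A : ∀ S ∈ 𝓛, S ⊆ A ∧ S.Nonempty)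
    (hlam : ∀ S ∈ 𝓛, ∀ T ∈ 𝓛, Disjoint S T ∨ S ⊆ T ∨ T ⊆ S) :
    ∑ S ∈ 𝓛, (prodBernoulli w).real {ω | ω ∉ openConn o b ∧ A.filter (fun a => ω ∈ openConn o a) = S} ≤
      2 * Real.sqrt (δ * (prodBernoulli w).real {ω | ω ∉ openConn o b ∧ ∃ a ∈ A, ω ∈ openConn o a} *
          (2 * Real.log (1 / (prodBernoulli w).real {ω | ω ∉ openConn o b ∧ ∀ a ∈ A, ω ∉ openConn o a}))) +
        3 * δ * (2 * Real.log (1 / (prodBernoulli w).real {ω | ω ∉ openConn o b ∧ ∀ a ∈ A, ω ∉ openConn o a})) := by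
  set p₀ := (prodBernoulli w).real {ω | ω ∉ openConn o b ∧ ∀ a ∈ A, ω ∉ openConn o a} with hp₀def
  have hp₀δ : p₀ ≤ δ := by
    refine le_trans (measureReal_mono ?_ (measure_ne_top _ _)) hA
    rintro ω ⟨_, hA'⟩ hω
    simp only [Set.mem_iUnion, exists_prop] at hω
    obtain ⟨a, ha, hoa⟩ := hω
    exact hA' a ha hoa
  have hδ0 : 0 ≤ δ := le_of_lt (lt_of_lt_of_le hp0 hp₀δ)
  have hΛ : 0 < 2 * Real.log (1 / p₀) := by
    have : 1 < 1 / p₀ := by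
      rw [lt_div_iff₀ hp0]
      linarith
    have := Real.log_pos this
    linarith
  have h := laminar_mass_le A
    (fun S => (prodBernoulli w).real {ω | ω ∉ openConn o b ∧ A.filter (fun a => ω ∈ openConn o a) = S})
    (fun _ => measureReal_nonneg) δ (2 * Real.log (1 / p₀)) hδ0 hΛ
    (fun a ha => (footprint_accumulation w A o b a).trans (hrel a ha))
    (fun ℬ η hη hℬA hℬdisj hℬη =>
      footprint_block_exclusivity w A o b ho hb hob δ hδ1 hA hrel hp0 ℬ η hη hℬA hℬdisj hℬη)
    𝓛 h𝓛A hlam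
  rw [sum_footprintMass_nonempty_eq] at h
  exact h

/-- **Laminar footprints theorem, registered form** (see `laminarFootprints`).
[cite: VandenbergHaggstromKahn2005, Thm 1.1; KozmaNitzan2024, Conj. 3 p.15 (context)] -/
theorem laminarFootprintMass : ∀ (n : ℕ) (w : Sym2 (Fin n) → unitInterval) (A : Finset (Fin n)) (o b : Fin n), o ∉ A → b ∉ A → o ≠ b → ∀ (δ : ℝ), δ < 1 → (Literature.Probability.LatticeModels.prodBernoulli w).real (⋃ a ∈ A, Literature.Probability.Percolation.openConn o a)ᶜ ≤ δ → (∀ a ∈ A, (Literature.Probability.LatticeModels.prodBernoulli w).real (Literature.Probability.Percolation.openConn a b)ᶜ ≤ δ) → 0 < (Literature.Probability.LatticeModels.prodBernoulli w).real {ω | ω ∉ Literature.Probability.Percolation.openConn o b ∧ ∀ a ∈ A, ω ∉ Literature.Probability.Percolation.openConn o a} → ∀ (𝓛 : Finset (Finset (Fin n))), (∀ S ∈ 𝓛, S ⊆ A ∧ S.Nonempty) → (∀ S ∈ 𝓛, ∀ T ∈ 𝓛, Disjoint S T ∨ S ⊆ T ∨ T ⊆ S) → ∑ S ∈ 𝓛,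 (Literature.Probability.LatticeModels.prodBernoulli w).real {ω | ω ∉ Literature.Probability.Percolation.openConn o b ∧ A.filter (fun a => ω ∈ Literature.Probability.Percolation.openConn o a) = S} ≤ 2 * Real.sqrt (δ * (Literature.Probability.LatticeModels.prodBernoulli w).real {ω | ω ∉ Literature.Probability.Percolation.openConn o b ∧ ∃ a ∈ A, ω ∈ Literature.Probability.Percolation.openConn o a} * (2 * Real.log (1 / (Literature.Probability.LatticeModels.prodBernoulli w).real {ω | ω ∉ Literature.Probability.Percolation.openConn o b ∧ ∀ a ∈ A, ω ∉ Literature.Probability.Percolation.openConn o a}))) + 3 * δ * (2 * Real.log (1 / (Literature.Probability.LatticeModels.prodBernoulli w).real {ω | ω ∉ Literature.Probability.Percolation.openConn o b ∧ ∀ a ∈ A, ω ∉ Literature.Probability.Percolation.openConn o a})) :=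
  fun _ w A o b ho hb hob δ hδ1 hA hrel hp0 𝓛 h𝓛A hlam =>
    laminarFootprints w A o b ho hb hob δ hδ1 hA hrel hp0 𝓛 h𝓛A hlam

end LaminarFootprints

end Summit.CriticalPhenomena.PercolationContinuityZ3.Theorems
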